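import Summits.CriticalPhenomena.CardyFormulaZ2.Theorems.CardyUSTContinuationKirchhoffExtremalLength
import Summits.CriticalPhenomena.CardyFormulaZ2.Theorems.CardyUSTContinuationKirchhoffExtremalLengthModulus
import Summits.CriticalPhenomena.CardyFormulaZ2.Theorems.CardyUSTContinuationUniformAnalyticExtensionStubRatioToCrux
import Literature.Probability.LatticeModels.FKTwoArcPartitionPolynomials
import HarnessLib

/-!
# Towards the stub `stub_zeroFreeCrossing` of the line `registered` for the crux
# `UniformAnalyticExtension` (stmt-CriticalPhenomena-6047, route `CardyUSTContinuation`)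

The stub asks, for every conformal rectangle `R` and `t₁ ∈ (0,1)`, for a `δ`-UNIFORM `ρ > 0` such
that for all small meshes `δ > 0` the crossing-restricted self-dual FK polynomial
`N_δ = fkTwoArcCrossingPolynomial R δ .joint ∈ ℕ[X]` has no zero in the complex `ρ`-neighbourhood
of `[t₁, 1]`.  The `δ`-uniform part is a Lee–Yang statement at criticality (open in print).  This
file settles the DEGENERATE and the PER-MESH content of the stub:

* `zeroFreeCrossing_eventually_reachable`: for every conformal rectangle, for all small `δ > 0`
  the two discrete arcs `A_δ`, `B_δ` of `(ab)`, `(cd)` are joined by a path of the discrete domain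
  `Ω_δ` (in particular both are nonempty) — from the convergence of the effective conductance
  `𝒞(A_δ ↔ B_δ; Ω_δ) → d_Ω((ab),(cd))⁻¹ > 0` (`KirchhoffExtremalLength` series);
* `zeroFreeCrossing_eventually_ne_zero`: hence `N_δ ≠ 0` in `ℕ[X]` for all small `δ > 0` (the
  all-open configuration crosses), so the stub is NOT vacuously false for coarse-mesh reasons;
* `zeroFreeCrossing_exists_thickening_of_ne_zero`: a nonzero `P ∈ ℕ[X]` is zero-free on some
  complex `ρ`-neighbourhood of `[t₁, 1]`, `t₁ > 0` (finitely many roots, none on `(0, ∞)`);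
* `zeroFreeCrossing_pointwise`: the stub with the quantifiers `∃ ρ` and `∀ᶠ δ` SWAPPED.

What remains is exactly the uniformity of `ρ` in `δ`.
-/

noncomputable section

open Filter Topology Set Polynomial Metric
open Literature.Probability.LatticeModels
open Literature.Probability.RandomPlanarGeometry (ConformalRectangle)

namespace Summit.CriticalPhenomena.CardyFormulaZ2.Cruxes.UniformAnalyticExtension.Birth

open Summit.CriticalPhenomena.CardyFormulaZ2.Theorems

/-- **The discrete arcs are eventually joined inside `Ω_δ`.** For every conformal rectangle `R`,
for all small `δ > 0` some vertex of the discrete arc of `(ab)` is joined to some vertex of the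
discrete arc of `(cd)` by a path of `Ω_δ = discreteDomainGraph R.carrier δ`: the effective
conductance between the discrete arcs tends to `d_Ω((ab),(cd))⁻¹ ∈ (0, ∞)`
(`KirchhoffSlope.tendsto_effectiveConductance_discreteArc`,
`ModulusIdentification.exists_extremalDistance_arc_eq`), and it vanishes when no such path exists.
[folklore] -/
theorem zeroFreeCrossing_eventually_reachable (R : ConformalRectangle) :
    ∀ᶠ δ in 𝓝[>] (0:ℝ), ∃ a ∈ discreteArc R.carrier δ (R.arc 0), ∃ z ∈ discreteArc R.carrier δ (R.arc 2),
      (discreteDomainGraph R.carrier δ).Reachable a z := by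
  have hT := KirchhoffSlope.tendsto_effectiveConductance_discreteArc R
  obtain ⟨r, hr, hd, -⟩ := ModulusIdentification.exists_extremalDistance_arc_eq R
  have hpos : (0 : ENNReal) <
      (Literature.Analysis.Complex.extremalDistance R.carrier (R.arc 0) (R.arc 2))⁻¹ := by
    rw [hd, ENNReal.inv_pos]
    exact ENNReal.ofReal_ne_top
  filter_upwards [(tendsto_order.1 hT).1 0 hpos] with δ hδ
  by_contra h
  refine hδ.ne' (effectiveConductance_eq_zero_of_not_reachable fun a ha z hz haz => ?_)
  exact h ⟨a, ha, z, hz, haz⟩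

/-- If the discrete arcs are joined by a path of `Ω_δ` (`δ > 0`), the crossing polynomial `N_δ`
is not the zero polynomial: the all-open configuration `ω = E(Ω_δ)` lies in the crossing event.
[folklore] -/
theorem zeroFreeCrossing_ne_zero_of_reachable (R : ConformalRectangle) {δ : ℝ} (hδ : 0 < δ)
    {a z : Site 2} (ha : a ∈ discreteArc R.carrier δ (R.arc 0))
    (hz : z ∈ discreteArc R.carrier δ (R.arc 2)) (h : (discreteDomainGraph R.carrier δ).Reachable a z)
    (w : ArcWiring) : fkTwoArcCrossingPolynomial R δ w ≠ 0 := by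
  classical
  letI : Fintype (meshDomain R.carrier δ) := (meshDomain_finite R.isBounded hδ).fintype
  rw [fkTwoArcCrossingPolynomial_of_pos R hδ]
  set G := domainSubgraph R.carrier δ with hG
  -- the all-open configuration crosses
  have hle : discreteDomainGraph R.carrier δ ≤
      Literature.Probability.Percolation.openGraph (Sym2.map Subtype.val '' (↑G.edgeFinset : Set (Sym2 (meshDomain R.carrier δ)))) := by
    intro x y hxy
    obtain ⟨-, hx, hy⟩ := discreteDomainGraph_adj_iff.1 hxy
    refine openGraph_lift_adj_iff.2 ⟨hx, hy, (Literature.Probability.Percolation.openGraph_adj _ _ _).2 ⟨?_, fun hxy' => ?_⟩⟩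
    · rw [Finset.mem_coe, SimpleGraph.mem_edgeFinset, SimpleGraph.mem_edgeSet, hG, domainSubgraph,
        SimpleGraph.comap_adj]
      exact hxy
    · exact hxy.ne (congrArg Subtype.val hxy')
  have hmem : G.edgeFinset ∈ G.edgeFinset.powerset.filter
      (fun ω : Finset (Sym2 (meshDomain R.carrier δ)) =>
        (↑ω : Literature.Probability.Percolation.BondConfig (meshDomain R.carrier δ)) ∈ rectCrossing R δ) := by
    refine Finset.mem_filter.2 ⟨Finset.mem_powerset.2 subset_rfl, ?_⟩
    exact ⟨a, ha, z, hz, h.mono (le_inf hle le_rfl)⟩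
  intro H
  have h1 := congrArg (aeval (1 : ℕ)) H
  rw [aeval_rcArcPolynomialIn, map_zero, Finset.sum_eq_zero_iff] at h1
  simpa using h1 _ hmem

/-- **`N_δ ≠ 0` for all small meshes.** For every conformal rectangle `R` and wiring `w`, for all
small `δ > 0` the two-arc crossing polynomial of `Ω_δ` is not the zero polynomial.  This is the
degenerate (coarse-mesh) content of `stub_zeroFreeCrossing`. [folklore] -/
theorem zeroFreeCrossing_eventually_ne_zero (R : ConformalRectangle) (w : ArcWiring) :
    ∀ᶠ δ in 𝓝[>] (0:ℝ), fkTwoArcCrossingPolynomial R δ w ≠ 0 := by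
  filter_upwards [zeroFreeCrossing_eventually_reachable R, self_mem_nhdsWithin] with δ hδr hδ
  obtain ⟨a, ha, z, hz, h⟩ := hδr
  exact zeroFreeCrossing_ne_zero_of_reachable R hδ ha hz h w

/-- A nonzero polynomial with natural coefficients is positive at every positive real point.
[folklore] -/
theorem zeroFreeCrossing_aeval_pos_of_ne_zero (P : ℕ[X]) (hP : P ≠ 0) {t : ℝ} (ht : 0 < t) :
    0 < aeval t P := by
  rw [aeval_eq_sum_range]
  have hlead : 0 < P.coeff P.natDegree := Nat.pos_of_ne_zero (mt leadingCoeff_eq_zero.1 hP)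
  refine lt_of_lt_of_le ?_ (Finset.single_le_sum (f := fun i => P.coeff i • t ^ i)
    (fun i _ => by simp only [nsmul_eq_mul]; positivity) (Finset.mem_range.2 (Nat.lt_succ_self _)))
  simp only [nsmul_eq_mul]
  have : (0:ℝ) < (P.coeff P.natDegree : ℝ) := Nat.cast_pos.2 hlead
  positivity

/-- **Per-polynomial zero-free neighbourhood.** A nonzero `P ∈ ℕ[X]` does not vanish on some
complex `ρ`-neighbourhood of the segment `[t₁, 1]`, `t₁ > 0`: its finitely many complex roots
form a closed set missing the compact segment (where `P > 0`). [folklore] -/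
theorem zeroFreeCrossing_exists_thickening_of_ne_zero (P : ℕ[X]) (hP : P ≠ 0) {t₁ : ℝ}
    (ht₁ : 0 < t₁) :
    ∃ ρ > (0:ℝ), ∀ z ∈ thickening ρ (((↑) : ℝ → ℂ) '' Set.Icc t₁ 1), aeval z P ≠ 0 := by
  have hmap : P.map (algebraMap ℕ ℂ) ≠ 0 :=
    (Polynomial.map_ne_zero_iff (algebraMap ℕ ℂ).injective_nat).2 hP
  set F : Set ℂ := {x : ℂ | IsRoot (P.map (algebraMap ℕ ℂ)) x} with hF
  have hFfin : F.Finite := finite_setOf_isRoot hmap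
  have hS : IsCompact (((↑) : ℝ → ℂ) '' Set.Icc t₁ 1) :=
    isCompact_Icc.image Complex.continuous_ofReal
  have hSF : ((↑) : ℝ → ℂ) '' Set.Icc t₁ 1 ⊆ Fᶜ := by
    rintro _ ⟨t, ht, rfl⟩ hroot
    have ht0 : 0 < t := ht₁.trans_le ht.1
    have hpos := zeroFreeCrossing_aeval_pos_of_ne_zero P hP ht0
    have h0 : aeval (t : ℂ) P = 0 := by
      have : (P.map (algebraMap ℕ ℂ)).eval (t : ℂ) = 0 := hroot
      rwa [eval_map, ← aeval_def] at this
    rw [← ratioToCrux_ofReal_aeval_natPoly, Complex.ofReal_eq_zero] at h0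
    exact hpos.ne' h0
  obtain ⟨ρ, hρ, hsub⟩ := hS.exists_thickening_subset_open hFfin.isClosed.isOpen_compl hSF
  refine ⟨ρ, hρ, fun z hz h0 => hsub hz ?_⟩
  change (P.map (algebraMap ℕ ℂ)).eval z = 0
  rwa [eval_map, ← aeval_def]

/-- **The stub with swapped quantifiers (per-mesh zero-freeness).** For every conformal rectangle
`R` and `t₁ ∈ (0,1)`, for all small `δ > 0` there is `ρ > 0` (depending on `δ`) such that
`N_δ(z) ≠ 0` on the complex `ρ`-neighbourhood of `[t₁, 1]`.  The registered stub
`stub_zeroFreeCrossing` is this statement with `ρ` uniform in `δ`. [folklore] -/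
theorem zeroFreeCrossing_pointwise :
    ∀ R : ConformalRectangle, ∀ t₁ ∈ Set.Ioo (0:ℝ) 1, ∀ᶠ δ in 𝓝[>] (0:ℝ), ∃ ρ > (0:ℝ),
      ∀ z ∈ thickening ρ (((↑) : ℝ → ℂ) '' Set.Icc t₁ 1),
        aeval z (fkTwoArcCrossingPolynomial R δ ArcWiring.joint) ≠ 0 := by
  intro R t₁ ht₁
  filter_upwards [zeroFreeCrossing_eventually_ne_zero R ArcWiring.joint] with δ hδ
  exact zeroFreeCrossing_exists_thickening_of_ne_zero _ hδ ht₁.1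

/-- **Real-segment zero-freeness, uniform in `δ`.** For every conformal rectangle `R`, for all
small `δ > 0` the crossing polynomial is positive at every real `t > 0` (so all the content of the
registered stub sits OFF the real axis). [folklore] -/
theorem zeroFreeCrossing_eventually_aeval_pos (R : ConformalRectangle) :
    ∀ᶠ δ in 𝓝[>] (0:ℝ), ∀ t : ℝ, 0 < t →
      0 < aeval t (fkTwoArcCrossingPolynomial R δ ArcWiring.joint) := by
  filter_upwards [zeroFreeCrossing_eventually_ne_zero R ArcWiring.joint] with δ hδ t ht
  exact zeroFreeCrossing_aeval_pos_of_ne_zero _ hδ ht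

end Summit.CriticalPhenomena.CardyFormulaZ2.Cruxes.UniformAnalyticExtension.Birth
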